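import Summits.BirchSwinnertonDyer.BirchSwinnertonDyer.Theorems.ResidualThetaTransportAtTwoSignedMuSeedAtTwoPlusJetTranslation
import HarnessLib

/-!
# Lever (i), second half, of the seed line `jet-character-sums` (crux `SignedMuSeedAtTwoPlus`, stmt-BirchSwinnertonDyer-21438;
# Kμ⁺ stmt-BirchSwinnertonDyer-20689; route `ResidualThetaTransportAtTwo`): the ODD JETS of `1/(x(Q′ ⊕ T(t)) − x_P)` in
# characteristic `2` — `[t¹] = d⁻²`, `[t³] = d⁻⁴`, `[t⁵] = [t²]²`, `[t⁷] = d⁻⁸` (`d = x′ − x_P`)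

Cell `bsd-wall`, width seat `bsd-wall-rtt-p4-w2` (g12). THEOREMS ONLY (no `def`, no named fact, no `sorry`); helper `--supports` the
seed crux; nothing about any curve, character sum or `μ`-invariant is asserted; BSD is not proved by this. The card
`Cruxes/SignedMuSeedAtTwoPlus/Ideas/jet-character-sums.md` (Lever (i)): «`D x = 1` on this model, so `x(Q′⊕T(t)) = x′ + t + x′²t² +
(y′²+1)t⁴ + x′⁴t⁶ + O(t⁸)` … whence the jet coefficients `c_n(Q′)` of `Φ_{Q′}(s) = Σ_P 1/(x(Q′⊕T(s)) − x_P)` are universal polynomials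
in the power sums `s_j(Q′) = Σ_P (x′ − x_P)^{−j}` and `(x′, y′)` with **`c₁ = s₁²`, `c₃ = s₁⁴`, `c₅ = c₂²`, `c₇ = s₁⁸`**». The first
clause is `…JetTranslation` (p671421, `translationJet`); this file proves the second, per summand, as exact `R⟦X⟧`-algebra:

* **`coeff_inv_jet`** — for a commutative ring `R` of characteristic `2`, `d e ∈ R` with `d e = 1`, any `a b`, any `q ∈ R⟦X⟧` with
  `q ≡ X + aX² + (1+b)X⁴ + a²X⁶ (mod X⁸)` (the jet of `x(Q′⊕T) − x′`, `a = x′²`, `b = y′²`) and any `φ` with `φ · (C d + q) = 1`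
  (`φ = 1/(x(Q′⊕T) − x_P)`, `d = x′ − x_P`): **`[X⁰]φ = e`, `[X¹]φ = e²`, `[X²]φ = e³ + a e²`, `[X³]φ = e⁴`, `[X⁵]φ = (e³ + a e²)²`,
  `[X⁷]φ = e⁸`** (also `[X⁴]`, `[X⁶]` in closed form). Mechanism: the coefficient recursion `Σ_{k ≤ n} φ_k ψ_{n−k} = [n = 0]` of
  `φ ψ = 1` (`PowerSeries.coeff_mul`), solved degree by degree; every cancellation is `2 = 0`.
* `coeff_inv_jet_frobenius` — the per-point Frobenius pattern `[X¹] = ([X⁰])²`, `[X³] = ([X⁰])⁴`, `[X⁵] = ([X²])²`,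
  `[X⁷] = ([X⁰])⁸`; summing over the points `P` with `𝔽₄`-weights is left to the consumer (`…JetFrobeniusCollapse.sum_mul_sq`).

References: the card (Lever (i)); [SilvermanAEC2009] IV.1.1.
-/

set_option autoImplicit false
set_option linter.dupNamespace false

noncomputable section

open PowerSeries

namespace Summit.BirchSwinnertonDyer.BirchSwinnertonDyer.Theorems.SignedMuAtTwo.JetCharacterSums

variable {R : Type*} [CommRing R] [CharP R 2]

/-- **The `7`-jet of `1/(d + q)` for the translation jet `q` (Lever (i) of the card, per point).** `R` of characteristic `2`,
`d e = 1`, `q ≡ X + aX² + (1+b)X⁴ + a²X⁶ (mod X⁸)` (the jet of `x(Q′⊕T) − x′`, `a = x′²`, `b = y′²`, from `…JetTranslation`), and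
`φ (C d + q) = 1` (`φ = 1/(x(Q′⊕T) − x_P)`, `d = x′ − x_P` a unit). Then
**`[X⁰]φ = e`, `[X¹]φ = e²`, `[X²]φ = e³ + a e²`, `[X³]φ = e⁴`, `[X⁵]φ = e⁶ + a² e⁴ = ([X²]φ)²`, `[X⁷]φ = e⁸`** (and `[X⁴]`,
`[X⁶]` in closed form): the source of the card's collapses `c₁ = s₁²`, `c₃ = s₁⁴`, `c₅ = c₂²`, `c₇ = s₁⁸` after summing over `P`
by Frobenius additivity (`…JetFrobeniusCollapse.sum_mul_sq`). Proof: the coefficient recursion `Σ_{k ≤ n} φ_k ψ_{n−k} = [n = 0]`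
of `φ ψ = 1`, solved degree by degree; all cancellations are `2 = 0`. [cite: SilvermanAEC2009, IV.1.1] -/
theorem coeff_inv_jet {d e a b : R} (hde : d * e = 1) {q φ : R⟦X⟧}
    (hq : X ^ 8 ∣ q - (X + C a * X ^ 2 + C (1 + b) * X ^ 4 + C (a ^ 2) * X ^ 6)) (hφ : φ * (C d + q) = 1) :
    coeff 0 φ = e ∧ coeff 1 φ = e ^ 2 ∧ coeff 2 φ = e ^ 3 + a * e ^ 2 ∧ coeff 3 φ = e ^ 4 ∧
      coeff 4 φ = e ^ 5 + a * e ^ 4 + a ^ 2 * e ^ 3 + (1 + b) * e ^ 2 ∧ coeff 5 φ = e ^ 6 + a ^ 2 * e ^ 4 ∧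
      coeff 6 φ = e ^ 7 + a * e ^ 6 + (a ^ 3 + 1 + b) * e ^ 4 + a ^ 2 * e ^ 2 ∧ coeff 7 φ = e ^ 8 := by
  have h2 : (2 : R) = 0 := CharTwo.two_eq_zero
  -- the coefficients of `q` below degree `8` are those of the jet polynomial
  have hqJ : ∀ k < 8, coeff k q = coeff k (X + C a * X ^ 2 + C (1 + b) * X ^ 4 + C (a ^ 2) * X ^ 6 : R⟦X⟧) := by
    intro k hk
    have := (X_pow_dvd_iff.mp hq) k hk
    rwa [map_sub, sub_eq_zero] at this
  have hqk : coeff 0 q = 0 ∧ coeff 1 q = 1 ∧ coeff 2 q = a ∧ coeff 3 q = 0 ∧ coeff 4 q = 1 + b ∧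
      coeff 5 q = 0 ∧ coeff 6 q = a ^ 2 ∧ coeff 7 q = 0 := by
    refine ⟨?_, ?_, ?_, ?_, ?_, ?_, ?_, ?_⟩ <;>
    · rw [hqJ _ (by norm_num)]
      simp only [map_add, map_one, add_mul, one_mul, coeff_C_mul, coeff_X_pow, coeff_X]
      norm_num
  obtain ⟨hq0, hq1, hq2, hq3, hq4, hq5, hq6, hq7⟩ := hqk
  -- the recursion `Σ_{k ≤ n} φ_k ψ_{n−k} = [n = 0]` from `φ ψ = 1`, `ψ = C d + q`
  have eqn : ∀ n, ∑ k ∈ Finset.range (n + 1), coeff k φ * coeff (n - k) (C d + q) = coeff n (1 : R⟦X⟧) := by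
    intro n
    rw [← hφ, coeff_mul, Finset.Nat.sum_antidiagonal_eq_sum_range_succ_mk]
  have e0 := eqn 0
  have e1 := eqn 1
  have e2 := eqn 2
  have e3 := eqn 3
  have e4 := eqn 4
  have e5 := eqn 5
  have e6 := eqn 6
  have e7 := eqn 7
  simp only [Finset.sum_range_succ, Finset.sum_range_zero, zero_add, map_add, coeff_C, coeff_one,
    hq0, hq1, hq2, hq3, hq4, hq5, hq6, hq7] at e0 e1 e2 e3 e4 e5 e6 e7
  norm_num at e0 e1 e2 e3 e4 e5 e6 e7
  have f0 : constantCoeff φ = e := by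
    linear_combination (-(constantCoeff φ)) * hde + e * e0
  have f1 : coeff 1 φ = e ^ 2 := by
    linear_combination (-(coeff 1 φ)) * hde + e * e1 + (-(e * 1)) * f0 + (-(e ^ 2)) * h2
  have f2 : coeff 2 φ = e ^ 3 + a * e ^ 2 := by
    linear_combination (-(coeff 2 φ)) * hde + e * e2 + (-(e * a)) * f0 + (-(e * 1)) * f1 + (-(e ^ 3 + a * e ^ 2)) * h2
  have f3 : coeff 3 φ = e ^ 4 := by
    linear_combination (-(coeff 3 φ)) * hde + e * e3 + (-(e * a)) * f1 + (-(e * 1)) * f2 + (-(e ^ 4 + a * e ^ 3)) * h2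
  have f4 : coeff 4 φ = e ^ 5 + a * e ^ 4 + a ^ 2 * e ^ 3 + (1 + b) * e ^ 2 := by
    linear_combination (-(coeff 4 φ)) * hde + e * e4 + (-(e * (1 + b))) * f0 + (-(e * a)) * f2 + (-(e * 1)) * f3 +
      (-(e ^ 2 + e ^ 5 + b * e ^ 2 + a * e ^ 4 + a ^ 2 * e ^ 3)) * h2
  have f5 : coeff 5 φ = e ^ 6 + a ^ 2 * e ^ 4 := by
    linear_combination (-(coeff 5 φ)) * hde + e * e5 + (-(e * (1 + b))) * f1 + (-(e * a)) * f3 + (-(e * 1)) * f4 +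
      (-(e ^ 3 + e ^ 6 + b * e ^ 3 + a * e ^ 5 + a ^ 2 * e ^ 4)) * h2
  have f6 : coeff 6 φ = e ^ 7 + a * e ^ 6 + (a ^ 3 + 1 + b) * e ^ 4 + a ^ 2 * e ^ 2 := by
    linear_combination (-(coeff 6 φ)) * hde + e * e6 + (-(e * a ^ 2)) * f0 + (-(e * (1 + b))) * f2 + (-(e * a)) * f4 +
      (-(e * 1)) * f5 + (-(e ^ 4 + e ^ 7 + b * e ^ 4 + a * e ^ 3 + a * e ^ 6 + a * b * e ^ 3 + a ^ 2 * e ^ 2 +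
        a ^ 2 * e ^ 5 + a ^ 3 * e ^ 4)) * h2
  have f7 : coeff 7 φ = e ^ 8 := by
    linear_combination (-(coeff 7 φ)) * hde + e * e7 + (-(e * a ^ 2)) * f1 + (-(e * (1 + b))) * f3 + (-(e * a)) * f5 +
      (-(e * 1)) * f6 + (-(e ^ 5 + e ^ 8 + b * e ^ 5 + a * e ^ 7 + a ^ 2 * e ^ 3 + a ^ 3 * e ^ 5)) * h2
  exact ⟨(coeff_zero_eq_constantCoeff_apply φ).trans f0, f1, f2, f3, f4, f5, f6, f7⟩

/-- **The Frobenius pattern of the odd jets**: `[X¹]φ = ([X⁰]φ)²`, `[X³]φ = ([X⁰]φ)⁴`, `[X⁵]φ = ([X²]φ)²`, `[X⁷]φ = ([X⁰]φ)⁸`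
(characteristic `2`). [cite: SilvermanAEC2009, IV.1.1] -/
theorem coeff_inv_jet_frobenius {d e a b : R} (hde : d * e = 1) {q φ : R⟦X⟧}
    (hq : X ^ 8 ∣ q - (X + C a * X ^ 2 + C (1 + b) * X ^ 4 + C (a ^ 2) * X ^ 6)) (hφ : φ * (C d + q) = 1) :
    coeff 1 φ = coeff 0 φ ^ 2 ∧ coeff 3 φ = coeff 0 φ ^ 4 ∧ coeff 5 φ = coeff 2 φ ^ 2 ∧ coeff 7 φ = coeff 0 φ ^ 8 := by
  obtain ⟨h0, h1, h2, h3, -, h5, -, h7⟩ := coeff_inv_jet hde hq hφ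
  have htwo : (2 : R) = 0 := CharTwo.two_eq_zero
  refine ⟨by rw [h1, h0], by rw [h3, h0], ?_, by rw [h7, h0]⟩
  rw [h5, h2]
  linear_combination (-(a * e ^ 5)) * htwo

end Summit.BirchSwinnertonDyer.BirchSwinnertonDyer.Theorems.SignedMuAtTwo.JetCharacterSums
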